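import Summits.QuantumFields.YangMills.Theorems.BalabanUVNodesN16InteriorLeafOfLooseLeaf
import Summits.QuantumFields.BalabanUV.T4Continuum.Support.MinimalActionWitness
import HarnessLib

/-!
# Route «BalabanUVNodes» (K3⁷ `SpineGivenEndpointR13SepCoPH`, stmt-QuantumFields-20544), DAG node N16 = NE3 — THE N16 → N19 JUNCTION'S INTERIOR LETTER, file 4:
# CAPTURE ⟸ [Balaban1985Variational] THEOREM 1 WITH ITS EXISTENCE CLAUSE (8) READ AT THE PROBLEM LEVEL

Cell `pub-ymgap`, width seat `pub-ymgap-dag-n16-w4` (director-ym R399 (3a) ∕ HUMAN RULING D-0149∕D-0154), generation 0′ (harness re-seat), file 4 — over this seat's files 1–3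
(`BalabanUVNodesN16CaptureOfUnique6` p607700, `…Top` p608885, `BalabanUVNodesN16InteriorLeafOfLooseLeaf` p610667) and dag-n16-w1's files 4∕7 (`…N16H7NoBinding` p593465,
`…N16InteriorOfCapture` p606074); located reading of record: this seat's `LOCATED-N16-EXISTS8-PROBLEM-LEVEL.md` (evidence #59 on stmt-QuantumFields-20544).
`--kind proof --supports stmt-QuantumFields-20544 --as helper` (count-neutral).  `bears_on: R4∕N16 · junction N16 → N19`.

THE POINT.  [Balaban1985Variational] Thm 1 p. 279 L8–12: *"for an arbitrary configuration V satisfying (7) with ε₁ ≤ a₁ there exists a minimal orbit in the space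
𝔘_k({Ω_j}, B₃ε₁) ∩ 𝔅_k(𝔅_k, V) (8). This orbit is a unique critical orbit in the space (6) if B₃ε₁ ≤ ε₀ and ε₀ ≤ a₀."*  The tree of record reads clause (8) at the SPACE
level — r2 `B11Thm1.Exists8` ∕ leaf-06 `torusVP` (`OnMinimalOrbit e V U := IsMinimiser d (sfClass d L N e) L N k V U`): «the functional (5) RESTRICTED to the small space (8)
attains its minimum» — call it (S).  Print's own usage reads it at the PROBLEM level — (P): «the minimal orbit OF THE PROBLEM (5)–(6), i.e. of the functional (5) on the space
(6) = 𝔘_k(ε₀) ∩ 𝔅_k(V), exists and LIES IN (8)»: p. 278 L34–37 *"we will prove that there exists a critical orbit of the functional (5). More exactly, we will prove that there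
exists a minimal orbit"* (the functional (5) lives on (6), L14–16), p. 281 L24–26 *"in the space (19)–(21)* [a chart of the WHOLE space (6), L2–8] *… there exists exactly one
critical configuration, which is a minimum of the functional (5)"*, p. 299 L22–35 (*"U_k belongs to the space (18) with ε₀ = O(1)C₁B₃ε₁ … U_k is a minimal configuration of the
functional A(U)"*), Prop. 7 L37–39, and the author's gloss of this theorem in [I] = CMP 109 p. 256 L20–28 *"the minimal configurations investigated in [15], i.e. the minima of
the functional U → A(U) on U : ū_k = M_k(U) = V … in a space of regular orbits there exists exactly one critical orbit, which is a set of minima"*, p. 260 L18–23.  In the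
tree's currency at one run: (P)-(8) := `∃ U₀, U₀ ∈ sfClass d L N ρ (k+1) ∧ IsMinimiser d (sfClass d L N ε⋆) L N (k+1) V U₀` — a minimiser over the BIG class located in the
SMALL class (`ρ = B₃ε₁`, `ε⋆` the problem's radius).  (P) ⟹ (S) (§4); (S) ⇏ (P), and (S) ∧ sentence 2 ∧ (9)–(10) do NOT give the junction's CAPTURE letter by logic (the
located note's §3: `f = x² + y²(1−x)³` — unique critical point, unique minimiser of the radius-1 disc, every minimiser of the radius-4 disc on the sphere).  WHAT (P) GIVES:
 * §1 (UNIQUENESS-FREE): every minimiser over an intermediate class `sfClass ε′`, `ρ ≤ ε′ ≤ ε⋆`, IS a minimiser over the top class (the (P)-witness pins the value — dag-n16-w1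
   file 4's `isMinimiser_inflate_of_capture`); and node N19's two `sel` rows of (v′-16) — a SELECTED minimiser of every run with sup-regularity at an interior value letter —
   from (P)-(8) and ANY loose leaf at radius `ρ` (value letter = class radius; dag-n16-w1's slot key or any other producer), with NO uniqueness and NO capture-∀
   (`exists_sel_of_loose_of_exists8P` = file 3's `exists_sel_of_loose_of_capture` with `hcap` ↦ (P)-(8));
 * §2 CAPTURE-∀ (every minimiser over `sfClass ε′` lies in `sfClass ρ`, for every `ρ ≤ ε′ ≤ ε`, `ε ≤ ε⋆`) from (P)-(8) at `ε⋆`, Thm 1 sentence 2 at `ε⋆` through a FREE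
   criticality predicate `Crit` ((U6)⋆, file 1∕2's shape VERBATIM), and «(ii-int)»: an `ε⋆`-minimiser that LIES IN `sfClass ε` is `Crit`.  For `ε < ε⋆` (ii-int) is CALCULUS
   in print's open balls AND at the tree's closed balls (a point of the closed `ε`-ball is interior to the `ε⋆`-ball; a minimum attained at an interior point of the constraint
   set is critical) — so files 1–2's honesty row (i) «(ii) at the closed ball = a located boundary law» DISAPPEARS on the (P)-road: by §1 an `ε′`-minimiser is an
   `ε⋆`-minimiser, it lies in `sfClass ε′ ⊆ sfClass ε`, hence is `Crit`, hence on the orbit of the (P)-witness `U₀` by (U6)⋆, hence in `sfClass ρ` by gauge invariance of the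
   ball (file 1's `mem_sfClass_of_orbit`).  Minimal-orbit currency (`…_of_uniqueInteriorMinimal`): uniqueness is asked ONLY of the `ε⋆`-minimisers lying in `sfClass ε`.
 * §2b a CONCRETE `Crit`: «interior LOCAL minimiser of `A^{(k+1)}` on `sfClass ε⋆ ∩ {Ū = V}`» (Mathlib `IsLocalMinOn`, product topology) — then (ii-int) is a THEOREM
   (a global minimum is a local one) and CAPTURE follows from (P)-(8)⋆ + sentence 2 for interior local minimisers ALONE (`capture_of_exists8P_of_unique6LocMin`): NO dictionary
   law displayed on this road; the displayed uniqueness is WEAKER than print's sentence 2 (local minima ⊂ critical points, by Fermat on the constraint manifold).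
 * §3 the interior leaf and node N19's (v′-16) conjunct at K3⁷ v5's loose pin, ONE application of file 3 each (key-free: the loose leaf is whatever producer is live).
 * §4 FAITHFULNESS: at leaf-06's torus instance with the minimal-orbit field read at the problem level (`OnMinimalOrbit _ V U := IsMinimiser d (sfClass d L N ε₀) …`), r2's
   `Exists8` IS (P)-(8) (`exists8_problemLevel_iff`, by `rfl`), and (P) ⟹ leaf-06's (S) clause for `B₃ε₁ ≤ ε₀` (`exists8_torusVP_of_problemLevel`); the converse is the
   located note's §3 (no kernel claim).  §5 A6: (P)-(8) is INHABITED at the flat datum for every pair of radii (`MinimalActionWitness.isMinimiser_sfClass_flatCfg` BY NAME).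

v1.1 (g0′, APPEND-ONLY): +§3b `sel_rateCarriers_of_pinnedLoose_of_loose_of_exists8P` — node N19's two `sel` rows AT K3⁷ v5's LOOSE PIN (every tuple and run length) from
(P)-(8) + any per-family loose leaf, UNIQUENESS-FREE (file 3's pin-level `sel` theorem with `hex ∧ hcap` ↦ (P)-(8)).

HONESTY ROWS.  (i) (P) is a READING of print's clause (8), located with page:line above and in the evidence note; the dictionary of record is (S) (D-s3-2 of
`Support/MinimalActionDictionary`); nothing here edits r2 or leaf-06 — the (P)-instance of §4 is built inline, `def`-free.  (ii) (P)-(8), (U6)⋆ and (ii-int) are DISPLAYED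
hypotheses, asserted for NO family: (P)-(8) and (U6)⋆ = [Balaban1985Variational] Thm 1 sentences 1–2 = node N07's theorem (its proof, Sects. B–F, is the content); (ii-int)
= calculus once `Crit` is a derivative-based notion (the tree has none; `Crit` is free).  (iii) ACCOUNTING, not a discharge: the gain over files 1–2 is that the junction's
∀-row now rests on Theorem 1's two sentences + one calculus row instead of «uniqueness of closed-ball minimisers» (= the proof's global minimality), and N19's `sel` rows on
sentence 1 ALONE.  LINEAGE ERRATA (referee ref-Q READ-21∕READ-23 NITs, folded here instead of a docstring-only edition): in files 1–2's prose «discharged 5∕27» read «5∕28»;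
«(2)–(8) p. 278» read «(2)–(7) p. 278, (8) p. 279»; file 1 §4–§5 display the `(hGm, hG, hM, hT)` bundle refuted at every rank by dag-n16-w2∕-w5 (p608145 ∕ p609621 ∕ p610394)
and are VACUOUS AS TYPED (author-located I.29768; read the interior letter from file 2 §1, file 3, or §2–§3 here); file 3's header names (o1)'s
`leafH3sup_loose_of_thm1AtBig` among loose-leaf producers — (o1) was WITHDRAWN (I.29935), the in-tree producers are dag-n16-w1's `…N16H7LooseOfReg910Slot.leafH3sup_loose_of_reg910Slot`
(slot key) and `…N16H7OfReg9.leafH3sup_loose_of_thm1At_torusVP` (old key, vacuous antecedent at rank ≥ 2) (ref-Q READ-30 N3).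

HONEST FRAMING.  Elementary nested-class ∕ value ∕ gauge-orbit logic over landed lemmas BY NAME; nothing of Bałaban asserted or refuted; no stub of K3⁷ v5 (`stub_rates13H` ∕
`stub_expansion13H`) closed; N16 ∕ N19 ∕ N07 NOT discharged; count-neutral (typed 28∕28 · discharged 5∕28 unmoved); one finite four-torus at fixed `ε`, Bałaban AS PRINTED —
NOT ℝ⁴, NOT infinite volume, NOT OS, NOT a mass gap; the YM mass gap (Clay) is NOT proved by any of this — R4 closes the conditional finite-𝕋⁴ rung `BalabanLadder.UV` only; no
summit statement is proved by this seat.  Context: [Balaban1985Variational] CMP **102** (1985) (2)–(7) p. 278, Thm 1 + (8)–(10) p. 279, p. 281, Prop. 7 p. 299;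
[Balaban1987RGI] CMP **109** (1987) pp. 256, 260. -/

set_option autoImplicit false

open scoped BigOperators Matrix Matrix.Norms.L2Operator
open NormedSpace

namespace Summit.QuantumFields.YangMills.BalabanUVNodes.N16CaptureOfExists8Problem

open Literature.MathematicalPhysics.QuantumFieldTheory.Balaban1983to89
open Literature.MathematicalPhysics.QuantumFieldTheory.Balaban1983to89.T4Continuum (T4Family ULoop)
open B7Prop1Explicit B7Prop2Explicit MatrixLog UnitaryModel
open T4AveragingDeficitWall hiding Site Plane Plaq Bond
open Summit.QuantumFields.BalabanUV.T4Continuum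
open MinimalActionSandwich (IsMinimiser minAct admissible)
open MinimalActionLevels (levelAction)
open MinimalActionRate (sfClass)
open MinimalActionRefine (RegularSup)
open MinimalActionDictionary (torusVP sfClass_mono isMinimiser_zero)
open MinimalActionWitness (flatCfg flatCfg_mem_sfClass isMinimiser_sfClass_flatCfg)
open LevelZeroRegular (regularSup_zero_of_sfClass_le)
open NE3.LeafIndexSockets (LeafH3sup)
open NE3EnergyShapes (IsUnitarySite IsPeriodicSite)
open B11Thm1 (Exists8)
open Node00 (Stage13HParams NE3Letters₁₁ ne3NperOfRecord₁₁ ne3DomOfRecord₁₁ MatA)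
open YMDAG.UVSplit (RateReading₁₃CoPH rateCarriersOfRecord₁₃CoPH)
open Summit.QuantumFields.YangMills.BalabanUVNodes.N16H7NoBinding (isMinimiser_inflate_of_capture)
open Summit.QuantumFields.YangMills.BalabanUVNodes.N16InteriorOfCapture (isMinimiser_of_capture minAct_eq_of_capture)
open Summit.QuantumFields.YangMills.BalabanUVNodes.N16CaptureOfUnique6 (mem_sfClass_of_orbit)
open Summit.QuantumFields.YangMills.BalabanUVNodes.N16InteriorLeafOfLooseLeaf (leafH3sup_interior_of_loose_of_capture
  leafH3sup_rateCarriers_of_pinnedLoose_of_loose_of_capture)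
open Summit.QuantumFields.YangMills.BalabanUVNodes.N16PinnedLayer13CoPH (N16PinnedLoose)

noncomputable section

section Generic

variable {d : ℕ} {n : Type} [Fintype n] [DecidableEq n]

/-! ## §1 (P)-(8), uniqueness-free: intermediate minimisers are top minimisers; node N19's `sel` rows -/

/-- **THE LIFT.**  Under (P)-(8) at the radii `(ρ, ε⋆)` — a configuration `U₀ ∈ sfClass d L N ρ k` minimising run `k` over the BIG class `sfClass d L N ε⋆` at the datum `V`
([Balaban1985Variational] Thm 1 (8) read at the problem level) — EVERY minimiser over an intermediate class `sfClass d L N ε′`, `ρ ≤ ε′ ≤ ε⋆`, is a minimiser over the top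
class: `U₀` is `ε′`-admissible, so the two minimal actions agree (dag-n16-w1 file 4's `isMinimiser_inflate_of_capture`).  No uniqueness, no (9)–(10).
[cite: Balaban1985Variational, Thm 1 (8) p.279] -/
theorem isMinimiser_top_of_exists8P {L N k : ℕ} {ρ ε' εTop : ℝ} (hρε' : ρ ≤ ε') (hε'T : ε' ≤ εTop)
    {V U₀ U : Site d → Fin d → (Matrix n n ℂ)ˣ} (hU₀mem : U₀ ∈ sfClass d L N ρ k) (hU₀ : IsMinimiser d (sfClass d L N εTop) L N k V U₀)
    (hU : IsMinimiser d (sfClass d L N ε') L N k V U) : IsMinimiser d (sfClass d L N εTop) L N k V U :=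
  isMinimiser_inflate_of_capture (sfClass_mono hε'T) hU hU₀ (sfClass_mono hρε' hU₀mem)

/-- **NO-BINDING ON THE WHOLE RANGE, FROM (P)-(8) ALONE**: `A^{ε′}_k(V) = A^{ε⋆}_k(V)` for every `ρ ≤ ε′ ≤ ε⋆` (dag-n16-w1 file 7's `minAct_eq_of_capture` at the (P)-witness;
recorded here because under the space-level reading (S) this equality is exactly what Theorem 1 does NOT supply — the located note's §3). [cite: Balaban1985Variational, Thm 1 (8) p.279] -/
theorem minAct_eq_of_exists8P {L N k : ℕ} {ρ ε' εTop : ℝ} (hρε' : ρ ≤ ε') (hε'T : ε' ≤ εTop)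
    {V U₀ : Site d → Fin d → (Matrix n n ℂ)ˣ} (hU₀mem : U₀ ∈ sfClass d L N ρ k) (hU₀ : IsMinimiser d (sfClass d L N εTop) L N k V U₀) :
    minAct d (sfClass d L N ε') L N k V = minAct d (sfClass d L N εTop) L N k V :=
  minAct_eq_of_capture hρε' hε'T hU₀ hU₀mem

/-- **★ NODE N19's TWO `sel` ROWS OF (v′-16), UNIQUENESS-FREE, FROM (P)-(8) AND ANY LOOSE LEAF** (file 3's `exists_sel_of_loose_of_capture` with its displayed CAPTURE-∀
replaced by (P)-(8)).  Displayed: the loose leaf `LeafH3sup d L N ρ ρ c D` at radius `ρ` (value letter = class radius: [Balaban1985Variational] Thm 1 (9)–(10) for the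
`ρ`-minimisers in any typing — dag-n16-w1's slot key (T9ˢ)+(T8), …); (P)-(8) at `(ρ, ε⋆)` at every datum of `D` and every run `k+1`; N19's own letter rows `ρ ≤ b`,
`c ≤ c'`, and a datum radius `ε₁ ≤ min(ε⋆, 1∕4, b, c'∕4)` with `D ⊆ sfClass d L N ε₁ 0` (run `0` = the datum: `isMinimiser_zero`, `LevelZeroRegular`).  Conclusion: a selection
`sel` with `sel k V` a minimiser of run `k` over `sfClass d L N ε⋆` and `RegularSup d L N b c' k (sel k V)` — the problem's captured minimiser `U₀` itself, which is a
`ρ`-minimiser (`isMinimiser_of_capture`) and hence regular by the loose leaf.  NO uniqueness sentence, NO capture of the other minimisers.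
[cite: Balaban1985Variational, Thm 1 (8)–(10) p.279] -/
theorem exists_sel_of_loose_of_exists8P {L N : ℕ} {ρ εTop c b c' ε₁ : ℝ} {D : Set (Site d → Fin d → (Matrix n n ℂ)ˣ)}
    (hloose : LeafH3sup d L N ρ ρ c D) (hρT : ρ ≤ εTop)
    (h8P : ∀ V ∈ D, ∀ k : ℕ, ∃ U₀ : Site d → Fin d → (Matrix n n ℂ)ˣ,
      U₀ ∈ sfClass d L N ρ (k + 1) ∧ IsMinimiser d (sfClass d L N εTop) L N (k + 1) V U₀)
    (hρb : ρ ≤ b) (hcc : c ≤ c') (hε₁T : ε₁ ≤ εTop) (hε₁ : ε₁ ≤ 1 / 4) (hε₁b : ε₁ ≤ b) (hε₁c : 4 * ε₁ ≤ c') (hD₁ : D ⊆ sfClass d L N ε₁ 0) :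
    ∃ sel : ℕ → (Site d → Fin d → (Matrix n n ℂ)ˣ) → (Site d → Fin d → (Matrix n n ℂ)ˣ),
      (∀ V ∈ D, ∀ k : ℕ, IsMinimiser d (sfClass d L N εTop) L N k V (sel k V)) ∧
      (∀ V ∈ D, ∀ k : ℕ, RegularSup d L N b c' k (sel k V)) := by
  classical
  have hex' : ∀ (k : ℕ) (V : Site d → Fin d → (Matrix n n ℂ)ˣ), ∃ U₀ : Site d → Fin d → (Matrix n n ℂ)ˣ,
      V ∈ D → U₀ ∈ sfClass d L N ρ (k + 1) ∧ IsMinimiser d (sfClass d L N εTop) L N (k + 1) V U₀ := by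
    intro k V
    by_cases hV : V ∈ D
    · obtain ⟨U₀, hU₀⟩ := h8P V hV k
      exact ⟨U₀, fun _ => hU₀⟩
    · exact ⟨V, fun h => absurd h hV⟩
  choose sel hsel using hex'
  refine ⟨fun k V => match k with | 0 => V | k + 1 => sel k V, fun V hV k => ?_, fun V hV k => ?_⟩
  · cases k with
    | zero => exact isMinimiser_zero (sfClass_mono hε₁T (hD₁ hV))
    | succ k => exact (hsel k V hV).2
  · cases k with
    | zero => exact regularSup_zero_of_sfClass_le hε₁ hε₁b hε₁c (hD₁ hV)
    | succ k =>
      obtain ⟨hmem, hmin⟩ := hsel k V hV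
      exact (hloose V hV k _ (isMinimiser_of_capture hρT hmin hmem)).mono hρb hcc

/-! ## §2 CAPTURE-∀ from (P)-(8) at the top radius, the uniqueness sentence there, and interior criticality -/

/-- **★★ CAPTURE ⟸ (P)-(8)⋆ ∧ (U6)⋆ ∧ (ii-int), ONE DATUM `V`, ONE RUN `k+1`.**  Radii `ρ ≤ ε′ ≤ ε ≤ ε⋆`; `Crit` a FREE predicate («`U` is a critical configuration of (5)
on the constraint manifold `{Ū = V}`»).  Displayed: `hU₀mem`, `hU₀` — (P)-(8) at `(ρ, ε⋆)`: `U₀ ∈ sfClass d L N ρ (k+1)` minimises over `sfClass d L N ε⋆` at `V`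
([Balaban1985Variational] Thm 1 sentence 1 read at the problem level); `hU6` — Thm 1 sentence 2 at `ε₀ := ε⋆` through `Crit` (file 1's shape VERBATIM): every
`Crit`-configuration of `sfClass d L N ε⋆ (k+1) ∩ {Ū = V}` lies on the gauge orbit of `U₀`; `hcritI` — (ii-int): an `ε⋆`-minimiser at `V` that LIES IN `sfClass d L N ε (k+1)`
is `Crit` (for `ε < ε⋆`: an interior point of the `ε⋆`-ball where the constrained minimum is attained — calculus in print; DISPLAYED here since `Crit` is free).  Conclusion:
every minimiser over `sfClass d L N ε′` at `V` lies in `sfClass d L N ρ (k+1)`.  Proof: §1's lift makes it an `ε⋆`-minimiser; it lies in `sfClass ε′ ⊆ sfClass ε`, so it is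
`Crit`; (U6)⋆ puts it on `U₀`'s orbit; the ball is gauge invariant (file 1's `mem_sfClass_of_orbit`). [cite: Balaban1985Variational, Thm 1 p.279] -/
theorem capture_of_exists8P_of_unique6_of_critInterior [Nonempty n] {L N k : ℕ} {ρ ε εTop : ℝ} (hεT : ε ≤ εTop)
    (Crit : (Site d → Fin d → (Matrix n n ℂ)ˣ) → (Site d → Fin d → (Matrix n n ℂ)ˣ) → Prop)
    {V U₀ : Site d → Fin d → (Matrix n n ℂ)ˣ} (hU₀mem : U₀ ∈ sfClass d L N ρ (k + 1)) (hU₀ : IsMinimiser d (sfClass d L N εTop) L N (k + 1) V U₀)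
    (hU6 : ∀ U : Site d → Fin d → (Matrix n n ℂ)ˣ, U ∈ sfClass d L N εTop (k + 1) → avgIter L U (k + 1) = V → Crit V U →
      ∃ u : Site d → (Matrix n n ℂ)ˣ, IsUnitarySite u ∧ IsPeriodicSite u ((N * L ^ (k + 1) : ℕ) : ℤ) ∧ gaugeAct u U₀ = U)
    (hcritI : ∀ U : Site d → Fin d → (Matrix n n ℂ)ˣ, IsMinimiser d (sfClass d L N εTop) L N (k + 1) V U → U ∈ sfClass d L N ε (k + 1) → Crit V U)
    {ε' : ℝ} (hρε' : ρ ≤ ε') (hε'ε : ε' ≤ ε)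
    {U : Site d → Fin d → (Matrix n n ℂ)ˣ} (hU : IsMinimiser d (sfClass d L N ε') L N (k + 1) V U) :
    U ∈ sfClass d L N ρ (k + 1) := by
  have hUtop : IsMinimiser d (sfClass d L N εTop) L N (k + 1) V U := isMinimiser_top_of_exists8P hρε' (hε'ε.trans hεT) hU₀mem hU₀ hU
  exact mem_sfClass_of_orbit hU₀mem (hU6 U hUtop.mem.1 hUtop.mem.2 (hcritI U hUtop (sfClass_mono hε'ε hU.mem.1)))

/-- **★ THE SAME IN MINIMAL-ORBIT CURRENCY: UNIQUENESS ASKED ONLY OF THE INTERIOR TOP MINIMISERS.**  Displayed: (P)-(8) at `(ρ, ε⋆)` as above, and `huniqI` — every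
minimiser of run `k+1` over `sfClass d L N ε⋆` at `V` that lies in `sfClass d L N ε (k+1)` is gauge equivalent to `U₀` ((U6)⋆ ∘ (ii-int)).  Conclusion: CAPTURE(ε′ → ρ) at `V`
for every `ρ ≤ ε′ ≤ ε ≤ ε⋆`. [cite: Balaban1985Variational, Thm 1 p.279] -/
theorem capture_of_exists8P_of_uniqueInteriorMinimal [Nonempty n] {L N k : ℕ} {ρ ε εTop : ℝ} (hεT : ε ≤ εTop)
    {V U₀ : Site d → Fin d → (Matrix n n ℂ)ˣ} (hU₀mem : U₀ ∈ sfClass d L N ρ (k + 1)) (hU₀ : IsMinimiser d (sfClass d L N εTop) L N (k + 1) V U₀)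
    (huniqI : ∀ U : Site d → Fin d → (Matrix n n ℂ)ˣ, IsMinimiser d (sfClass d L N εTop) L N (k + 1) V U → U ∈ sfClass d L N ε (k + 1) →
      ∃ u : Site d → (Matrix n n ℂ)ˣ, IsUnitarySite u ∧ IsPeriodicSite u ((N * L ^ (k + 1) : ℕ) : ℤ) ∧ gaugeAct u U₀ = U)
    {ε' : ℝ} (hρε' : ρ ≤ ε') (hε'ε : ε' ≤ ε)
    {U : Site d → Fin d → (Matrix n n ℂ)ˣ} (hU : IsMinimiser d (sfClass d L N ε') L N (k + 1) V U) :
    U ∈ sfClass d L N ρ (k + 1) := by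
  have hUtop : IsMinimiser d (sfClass d L N εTop) L N (k + 1) V U := isMinimiser_top_of_exists8P hρε' (hε'ε.trans hεT) hU₀mem hU₀ hU
  exact mem_sfClass_of_orbit hU₀mem (huniqI U hUtop (sfClass_mono hε'ε hU.mem.1))

/-- **★★ CAPTURE(ε′ → ρ) ON A DATA SET `D` FOR EVERY `ρ ≤ ε′ ≤ ε`, FROM (P)-(8)⋆ ON `D`, (U6)⋆ AND (ii-int)** — the data-set form feeding file 3 and node N19's rows.  `Crit`
free (run-indexed); `h8P` — (P)-(8) at `(ρ, ε⋆)` at every datum of `D` and every run; `hU6top` — [Balaban1985Variational] Thm 1 sentence 2 ∘ r2 `Laws` (iv) at `ε⋆` in file 2's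
shape VERBATIM (the orbit of ANY `ρ`-minimiser `U₀` at the datum carries every `Crit`-configuration of `sfClass ε⋆ ∩ {Ū = V}`; the (P)-witness is such a `U₀` by
`isMinimiser_of_capture`); `hcritI` — (ii-int) at the pair `(ε, ε⋆)`.  No existence row at `ε′` is needed (contrast file 2's `hexTop`∕`capture_mono_outer`): the lift of §1
replaces it. [cite: Balaban1985Variational, Thm 1 p.279] -/
theorem capture_on_of_exists8P_of_unique6_of_critInterior [Nonempty n] {L N : ℕ} {ρ ε εTop : ℝ} (hεT : ε ≤ εTop) {D : Set (Site d → Fin d → (Matrix n n ℂ)ˣ)}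
    (Crit : ℕ → (Site d → Fin d → (Matrix n n ℂ)ˣ) → (Site d → Fin d → (Matrix n n ℂ)ˣ) → Prop)
    (h8P : ∀ V ∈ D, ∀ k : ℕ, ∃ U₀ : Site d → Fin d → (Matrix n n ℂ)ˣ,
      U₀ ∈ sfClass d L N ρ (k + 1) ∧ IsMinimiser d (sfClass d L N εTop) L N (k + 1) V U₀)
    (hU6top : ∀ (k : ℕ), ∀ V ∈ D, ∀ U₀ : Site d → Fin d → (Matrix n n ℂ)ˣ, IsMinimiser d (sfClass d L N ρ) L N (k + 1) V U₀ →
      ∀ U : Site d → Fin d → (Matrix n n ℂ)ˣ, U ∈ sfClass d L N εTop (k + 1) → avgIter L U (k + 1) = V → Crit k V U →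
        ∃ u : Site d → (Matrix n n ℂ)ˣ, IsUnitarySite u ∧ IsPeriodicSite u ((N * L ^ (k + 1) : ℕ) : ℤ) ∧ gaugeAct u U₀ = U)
    (hcritI : ∀ (k : ℕ) (V U : Site d → Fin d → (Matrix n n ℂ)ˣ), IsMinimiser d (sfClass d L N εTop) L N (k + 1) V U →
      U ∈ sfClass d L N ε (k + 1) → Crit k V U)
    {ε' : ℝ} (hρε' : ρ ≤ ε') (hε'ε : ε' ≤ ε) :
    ∀ V ∈ D, ∀ (k : ℕ) (U : Site d → Fin d → (Matrix n n ℂ)ˣ),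
      IsMinimiser d (sfClass d L N ε') L N (k + 1) V U → U ∈ sfClass d L N ρ (k + 1) := by
  intro V hV k U hU
  obtain ⟨U₀, hU₀mem, hU₀⟩ := h8P V hV k
  have hU₀ρ : IsMinimiser d (sfClass d L N ρ) L N (k + 1) V U₀ := isMinimiser_of_capture (hρε'.trans (hε'ε.trans hεT)) hU₀ hU₀mem
  exact capture_of_exists8P_of_unique6_of_critInterior hεT (Crit k) hU₀mem hU₀ (hU6top k V hV U₀ hU₀ρ) (hcritI k V) hρε' hε'ε hU

/-! ## §2b A concrete criticality predicate: INTERIOR LOCAL MINIMISERS of (5) on (6) — (ii-int) becomes a theorem -/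

/-- **(ii-int) IS A THEOREM FOR THE LOCAL-MINIMUM READING OF `Crit`.**  Take `Crit V U :=` «`U ∈ sfClass d L N ε (k+1)` and `U` is a LOCAL minimiser of the level action
`A^{(k+1)}` on the constraint set `admissible (sfClass d L N ε⋆) L (k+1) V = sfClass ε⋆ ∩ {Ū = V}`» (Mathlib's `IsLocalMinOn` in the product topology of the configuration
space).  Then every `ε⋆`-minimiser lying in `sfClass ε` is `Crit` — a global minimum is a local one (`IsMinOn.localize`).  No display, no dictionary law. [folklore] -/
theorem critLocMin_of_isMinimiser_of_mem {L N k : ℕ} {ε εTop : ℝ} {V U : Site d → Fin d → (Matrix n n ℂ)ˣ}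
    (hU : IsMinimiser d (sfClass d L N εTop) L N (k + 1) V U) (hmem : U ∈ sfClass d L N ε (k + 1)) :
    U ∈ sfClass d L N ε (k + 1) ∧
      IsLocalMinOn (fun W : Site d → Fin d → (Matrix n n ℂ)ˣ => levelAction d L N (k + 1) W) (admissible (sfClass d L N εTop) L (k + 1) V) U :=
  ⟨hmem, (show IsMinOn (fun W : Site d → Fin d → (Matrix n n ℂ)ˣ => levelAction d L N (k + 1) W)
    (admissible (sfClass d L N εTop) L (k + 1) V) U from fun W hW => hU.le W hW).localize⟩

/-- **★★ CAPTURE ⟸ (P)-(8)⋆ ∧ THEOREM 1 SENTENCE 2 FOR INTERIOR LOCAL MINIMISERS — NOTHING ELSE DISPLAYED.**  Radii `ρ ≤ ε′ ≤ ε ≤ ε⋆`, one datum `V`, one run `k+1`.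
Displayed: (P)-(8) at `(ρ, ε⋆)` (`hU₀mem`, `hU₀`: [Balaban1985Variational] Thm 1 sentence 1 at the problem level) and `hU6loc` — sentence 2 at `ε₀ := ε⋆` SPECIALISED to interior
local minimisers: every configuration of `sfClass d L N ε⋆ (k+1) ∩ {Ū = V}` that lies in `sfClass d L N ε (k+1)` and locally minimises `A^{(k+1)}` on that constraint set is on
the gauge orbit of `U₀`.  For `ε < ε⋆` this is print's sentence 2 («unique critical orbit in the space (6)») composed with Fermat's theorem on the constraint manifold (an
interior local minimiser of (5) on (6) is a critical orbit) — calculus in print, and WEAKER than sentence 2 as printed (fewer configurations qualify); the tree has no derivative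
of the Wilson action along `{Ū = V}`, so the composed form is the displayed one.  Conclusion: every minimiser over `sfClass d L N ε′` at `V` lies in `sfClass d L N ρ (k+1)` — §2
at this `Crit`, (ii-int) discharged by `critLocMin_of_isMinimiser_of_mem`.  No located dictionary law remains on this road (contrast files 1–2's honesty row (i)).
[cite: Balaban1985Variational, Thm 1 p.279] -/
theorem capture_of_exists8P_of_unique6LocMin [Nonempty n] {L N k : ℕ} {ρ ε εTop : ℝ} (hεT : ε ≤ εTop)
    {V U₀ : Site d → Fin d → (Matrix n n ℂ)ˣ} (hU₀mem : U₀ ∈ sfClass d L N ρ (k + 1)) (hU₀ : IsMinimiser d (sfClass d L N εTop) L N (k + 1) V U₀)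
    (hU6loc : ∀ U : Site d → Fin d → (Matrix n n ℂ)ˣ, U ∈ sfClass d L N εTop (k + 1) → avgIter L U (k + 1) = V → U ∈ sfClass d L N ε (k + 1) →
      IsLocalMinOn (fun W : Site d → Fin d → (Matrix n n ℂ)ˣ => levelAction d L N (k + 1) W) (admissible (sfClass d L N εTop) L (k + 1) V) U →
        ∃ u : Site d → (Matrix n n ℂ)ˣ, IsUnitarySite u ∧ IsPeriodicSite u ((N * L ^ (k + 1) : ℕ) : ℤ) ∧ gaugeAct u U₀ = U)
    {ε' : ℝ} (hρε' : ρ ≤ ε') (hε'ε : ε' ≤ ε)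
    {U : Site d → Fin d → (Matrix n n ℂ)ˣ} (hU : IsMinimiser d (sfClass d L N ε') L N (k + 1) V U) :
    U ∈ sfClass d L N ρ (k + 1) :=
  capture_of_exists8P_of_unique6_of_critInterior hεT
    (fun V' U' => U' ∈ sfClass d L N ε (k + 1) ∧
      IsLocalMinOn (fun W : Site d → Fin d → (Matrix n n ℂ)ˣ => levelAction d L N (k + 1) W) (admissible (sfClass d L N εTop) L (k + 1) V') U')
    hU₀mem hU₀ (fun U' h₁ h₂ h₃ => hU6loc U' h₁ h₂ h₃.1 h₃.2) (fun _ hmin hmem => critLocMin_of_isMinimiser_of_mem hmin hmem) hρε' hε'ε hU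

/-- **★ DATA-SET FORM OF THE LOCAL-MINIMUM ROAD**: CAPTURE(ε′ → ρ) on `D` for every `ρ ≤ ε′ ≤ ε` from (P)-(8)⋆ on `D` and sentence 2 for interior local minimisers at `ε⋆`, in
file 2's (U6)⋆ shape (the orbit of ANY `ρ`-minimiser at the datum) — feeds file 3 ∕ §3 exactly like `capture_on_of_exists8P_of_unique6_of_critInterior`, with no (ii) row.
[cite: Balaban1985Variational, Thm 1 p.279] -/
theorem capture_on_of_exists8P_of_unique6LocMin [Nonempty n] {L N : ℕ} {ρ ε εTop : ℝ} (hεT : ε ≤ εTop) {D : Set (Site d → Fin d → (Matrix n n ℂ)ˣ)}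
    (h8P : ∀ V ∈ D, ∀ k : ℕ, ∃ U₀ : Site d → Fin d → (Matrix n n ℂ)ˣ,
      U₀ ∈ sfClass d L N ρ (k + 1) ∧ IsMinimiser d (sfClass d L N εTop) L N (k + 1) V U₀)
    (hU6loc : ∀ (k : ℕ), ∀ V ∈ D, ∀ U₀ : Site d → Fin d → (Matrix n n ℂ)ˣ, IsMinimiser d (sfClass d L N ρ) L N (k + 1) V U₀ →
      ∀ U : Site d → Fin d → (Matrix n n ℂ)ˣ, U ∈ sfClass d L N εTop (k + 1) → avgIter L U (k + 1) = V → U ∈ sfClass d L N ε (k + 1) →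
        IsLocalMinOn (fun W : Site d → Fin d → (Matrix n n ℂ)ˣ => levelAction d L N (k + 1) W) (admissible (sfClass d L N εTop) L (k + 1) V) U →
          ∃ u : Site d → (Matrix n n ℂ)ˣ, IsUnitarySite u ∧ IsPeriodicSite u ((N * L ^ (k + 1) : ℕ) : ℤ) ∧ gaugeAct u U₀ = U)
    {ε' : ℝ} (hρε' : ρ ≤ ε') (hε'ε : ε' ≤ ε) :
    ∀ V ∈ D, ∀ (k : ℕ) (U : Site d → Fin d → (Matrix n n ℂ)ˣ),
      IsMinimiser d (sfClass d L N ε') L N (k + 1) V U → U ∈ sfClass d L N ρ (k + 1) := by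
  intro V hV k U hU
  obtain ⟨U₀, hU₀mem, hU₀⟩ := h8P V hV k
  have hU₀ρ : IsMinimiser d (sfClass d L N ρ) L N (k + 1) V U₀ := isMinimiser_of_capture (hρε'.trans (hε'ε.trans hεT)) hU₀ hU₀mem
  exact capture_of_exists8P_of_unique6LocMin hεT hU₀mem hU₀ (hU6loc k V hV U₀ hU₀ρ) hρε' hε'ε hU

/-! ## §3 The interior leaf and node N19's (v′-16) conjunct at K3⁷ v5's loose pin (one application of file 3 each) -/

/-- **★ THE INTERIOR LEAF `(ε′, ρ)` FOR EVERY `ρ ≤ ε′ ≤ ε` FROM ANY LOOSE LEAF AT `ρ` + (P)-(8)⋆ + (U6)⋆ + (ii-int)** (file 3's `leafH3sup_interior_of_loose_of_capture` fed by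
§2): every minimiser of every run `k+1` over `sfClass d L N ε′` at a datum of `D` has sup-regularity with VALUE letter `ρ` and gradient letter `c` — the interior letter of node
N19's (v′-16).  KEY-FREE: `hloose` is whatever produces the value-letter-equals-class-radius leaf. [cite: Balaban1985Variational, Thm 1 (8)–(10) p.279] -/
theorem leafH3sup_interior_of_loose_of_exists8P [Nonempty n] {L N : ℕ} {ρ ε εTop c : ℝ} (hεT : ε ≤ εTop) {D : Set (Site d → Fin d → (Matrix n n ℂ)ˣ)}
    (hloose : LeafH3sup d L N ρ ρ c D)
    (Crit : ℕ → (Site d → Fin d → (Matrix n n ℂ)ˣ) → (Site d → Fin d → (Matrix n n ℂ)ˣ) → Prop)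
    (h8P : ∀ V ∈ D, ∀ k : ℕ, ∃ U₀ : Site d → Fin d → (Matrix n n ℂ)ˣ,
      U₀ ∈ sfClass d L N ρ (k + 1) ∧ IsMinimiser d (sfClass d L N εTop) L N (k + 1) V U₀)
    (hU6top : ∀ (k : ℕ), ∀ V ∈ D, ∀ U₀ : Site d → Fin d → (Matrix n n ℂ)ˣ, IsMinimiser d (sfClass d L N ρ) L N (k + 1) V U₀ →
      ∀ U : Site d → Fin d → (Matrix n n ℂ)ˣ, U ∈ sfClass d L N εTop (k + 1) → avgIter L U (k + 1) = V → Crit k V U →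
        ∃ u : Site d → (Matrix n n ℂ)ˣ, IsUnitarySite u ∧ IsPeriodicSite u ((N * L ^ (k + 1) : ℕ) : ℤ) ∧ gaugeAct u U₀ = U)
    (hcritI : ∀ (k : ℕ) (V U : Site d → Fin d → (Matrix n n ℂ)ˣ), IsMinimiser d (sfClass d L N εTop) L N (k + 1) V U →
      U ∈ sfClass d L N ε (k + 1) → Crit k V U)
    {ε' : ℝ} (hρε' : ρ ≤ ε') (hε'ε : ε' ≤ ε) :
    LeafH3sup d L N ε' ρ c D :=
  leafH3sup_interior_of_loose_of_capture hloose hρε' (capture_on_of_exists8P_of_unique6_of_critInterior hεT Crit h8P hU6top hcritI hρε' hε'ε)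

end Generic

section AtReading

variable {N : ℕ} [NeZero N]

/-- **★ NODE N19's (v′-16) CONJUNCT AT EVERY TUPLE AND RUN LENGTH, UNDER K3⁷ v5's LOOSE PIN, ON THE (P)-ROAD** — one application of file 3's
`leafH3sup_rateCarriers_of_pinnedLoose_of_loose_of_capture`, its displayed CAPTURE((ℓ₃ F).ε → ρ F) supplied per family by §2.  Displayed per family `F`: a capture radius
`ρ F ≤ (ℓ₃ F).ε` with a loose leaf at `ρ F` on the pinned loose data `D_F = {V ∈ ne3DomOfRecord₁₁ F N 0 0 | V ∈ sfClass 4 F.L Nper ((ℓ₃ F).ε ∕ B F) 0}` (any producer); a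
problem radius `εTop F ≥ (ℓ₃ F).ε` with (P)-(8) at `(ρ F, εTop F)` on `D_F`; (U6)⋆ through a free `Crit F` and (ii-int) at the pair `((ℓ₃ F).ε, εTop F)`; the TIGHTENED MATCH
ROW `ρ F ≤ (ℓ₃ F).b` and the gradient row `c F ≤ c'`.  Nothing of the `(hGm, hG, hM, hT)` bundle is displayed. [cite: Balaban1985Variational, Thm 1 (8)–(10) p.279] -/
theorem leafH3sup_rateCarriers_of_pinnedLoose_of_loose_of_exists8P {𝔯 : RateReading₁₃CoPH N} {ℓ₃ : T4Family → NE3Letters₁₁} {B : T4Family → ℝ}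
    (hpin : N16PinnedLoose 𝔯 ℓ₃ B) {ρ c εTop : T4Family → ℝ}
    (hloose : ∀ F : T4Family, LeafH3sup 4 F.L (ne3NperOfRecord₁₁ F 0 0) (ρ F) (ρ F) (c F)
      ({V | V ∈ ne3DomOfRecord₁₁ F N 0 0 ∧ V ∈ sfClass 4 F.L (ne3NperOfRecord₁₁ F 0 0) ((ℓ₃ F).ε / B F) 0} : Set (Site 4 → Fin 4 → (MatA N)ˣ)))
    (hρε : ∀ F : T4Family, ρ F ≤ (ℓ₃ F).ε) (hεT : ∀ F : T4Family, (ℓ₃ F).ε ≤ εTop F)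
    (Crit : T4Family → ℕ → (Site 4 → Fin 4 → (MatA N)ˣ) → (Site 4 → Fin 4 → (MatA N)ˣ) → Prop)
    (h8P : ∀ (F : T4Family), ∀ V ∈ ({V | V ∈ ne3DomOfRecord₁₁ F N 0 0 ∧ V ∈ sfClass 4 F.L (ne3NperOfRecord₁₁ F 0 0) ((ℓ₃ F).ε / B F) 0} :
        Set (Site 4 → Fin 4 → (MatA N)ˣ)), ∀ k : ℕ, ∃ U₀ : Site 4 → Fin 4 → (MatA N)ˣ,
      U₀ ∈ sfClass 4 F.L (ne3NperOfRecord₁₁ F 0 0) (ρ F) (k + 1) ∧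
        IsMinimiser 4 (sfClass 4 F.L (ne3NperOfRecord₁₁ F 0 0) (εTop F)) F.L (ne3NperOfRecord₁₁ F 0 0) (k + 1) V U₀)
    (hU6top : ∀ (F : T4Family) (k : ℕ), ∀ V ∈ ({V | V ∈ ne3DomOfRecord₁₁ F N 0 0 ∧ V ∈ sfClass 4 F.L (ne3NperOfRecord₁₁ F 0 0) ((ℓ₃ F).ε / B F) 0} :
        Set (Site 4 → Fin 4 → (MatA N)ˣ)),
      ∀ U₀ : Site 4 → Fin 4 → (MatA N)ˣ, IsMinimiser 4 (sfClass 4 F.L (ne3NperOfRecord₁₁ F 0 0) (ρ F)) F.L (ne3NperOfRecord₁₁ F 0 0) (k + 1) V U₀ →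
      ∀ U : Site 4 → Fin 4 → (MatA N)ˣ, U ∈ sfClass 4 F.L (ne3NperOfRecord₁₁ F 0 0) (εTop F) (k + 1) → avgIter F.L U (k + 1) = V → Crit F k V U →
        ∃ u : Site 4 → (MatA N)ˣ, IsUnitarySite u ∧ IsPeriodicSite u ((ne3NperOfRecord₁₁ F 0 0 * F.L ^ (k + 1) : ℕ) : ℤ) ∧ gaugeAct u U₀ = U)
    (hcritI : ∀ (F : T4Family) (k : ℕ) (V U : Site 4 → Fin 4 → (MatA N)ˣ),
      IsMinimiser 4 (sfClass 4 F.L (ne3NperOfRecord₁₁ F 0 0) (εTop F)) F.L (ne3NperOfRecord₁₁ F 0 0) (k + 1) V U →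
        U ∈ sfClass 4 F.L (ne3NperOfRecord₁₁ F 0 0) (ℓ₃ F).ε (k + 1) → Crit F k V U)
    (F : T4Family) (θ : Stage13HParams F N) (hP : θ.Provisos₁₃CoPH F N) (g₀ : ℕ → ℝ) (os : List (ULoop F)) (k : ℕ)
    {c' : ℝ} (hρb : ρ F ≤ (ℓ₃ F).b) (hc : c F ≤ c') :
    LeafH3sup 4 (rateCarriersOfRecord₁₃CoPH 𝔯 F θ hP g₀ os k).ne3.L (rateCarriersOfRecord₁₃CoPH 𝔯 F θ hP g₀ os k).ne3.Nper
      (rateCarriersOfRecord₁₃CoPH 𝔯 F θ hP g₀ os k).ne3.ε (rateCarriersOfRecord₁₃CoPH 𝔯 F θ hP g₀ os k).ne3.b c'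
      (rateCarriersOfRecord₁₃CoPH 𝔯 F θ hP g₀ os k).ne3.dom :=
  leafH3sup_rateCarriers_of_pinnedLoose_of_loose_of_capture hpin hloose hρε
    (fun F' => capture_on_of_exists8P_of_unique6_of_critInterior (hεT F') (Crit F') (h8P F') (hU6top F') (hcritI F') (hρε F') le_rfl)
    F θ hP g₀ os k hρb hc

end AtReading

/-! ## §4 Faithfulness: (P)-(8) IS r2's `Exists8` at the torus instance whose minimal-orbit field is read at the problem level; (P) ⟹ (S) -/

section Faithful

variable {d : ℕ} {n : Type} [Fintype n] [DecidableEq n]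

/-- **(P)-(8) IS r2's `Exists8` AT THE PROBLEM-LEVEL TORUS INSTANCE.**  Replace, in leaf-06's instance `torusVP d L N G (k+1)`, the minimal-orbit field by its problem-level
reading at the problem's radius `ε₀` — `OnMinimalOrbit _ V U := IsMinimiser d (sfClass d L N ε₀) L N (k+1) V U` («`U` is on the minimal orbit of the functional (5) on the space
(6) = 𝔘(ε₀) ∩ 𝔅(V)»; the radius argument of the field, the LOCATION `B₃ε₁`, is carried by `Exists8`'s `InU` conjunct) — and nothing else: then r2's `B11Thm1.Exists8` at that
instance reads, definitionally, «there is `U₀ ∈ sfClass d L N (B₃ε₁) (k+1)` with `Ū₀ = V` minimising run `k+1` over `sfClass d L N ε₀`» = (P)-(8).  (The `InB` conjunct is also a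
field of `IsMinimiser`; it is kept as r2 prints it.)  `def`-free; D-s3-2 itself is not edited. [cite: Balaban1985Variational, Thm 1 (8) p.279] -/
theorem exists8_problemLevel_iff (L N : ℕ) (G : (Site d → Fin d → (Matrix n n ℂ)ˣ) → Site d → ℕ → ℝ → ℝ → ℝ → Prop) (k : ℕ) (ε₀ B₃ ε₁ : ℝ)
    (V : Site d → Fin d → (Matrix n n ℂ)ˣ) :
    Exists8 { torusVP d L N G (k + 1) with OnMinimalOrbit := fun _ V U => IsMinimiser d (sfClass d L N ε₀) L N (k + 1) V U } B₃ ε₁ V ↔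
      ∃ U₀ : Site d → Fin d → (Matrix n n ℂ)ˣ, U₀ ∈ sfClass d L N (B₃ * ε₁) (k + 1) ∧ avgIter L U₀ (k + 1) = V ∧
        IsMinimiser d (sfClass d L N ε₀) L N (k + 1) V U₀ :=
  Iff.rfl

/-- **(P) ⟹ (S) AT THE TORUS INSTANCE**: for `B₃ε₁ ≤ ε₀`, the problem-level existence clause implies leaf-06's space-level one (`Exists8 (torusVP …)`: a minimiser over the
SMALL class `sfClass d L N (B₃ε₁)`) — the located witness is `(B₃ε₁)`-admissible and beats every competitor of the bigger class (`isMinimiser_of_capture`).  The converse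
fails by logic (the located note's §3); it is print's proof (Sects. B–F) or print's reading (P) that supplies it, neither asserted here. [cite: Balaban1985Variational, Thm 1 (8) p.279] -/
theorem exists8_torusVP_of_problemLevel (L N : ℕ) (G : (Site d → Fin d → (Matrix n n ℂ)ˣ) → Site d → ℕ → ℝ → ℝ → ℝ → Prop) (k : ℕ) {ε₀ B₃ ε₁ : ℝ}
    (hle : B₃ * ε₁ ≤ ε₀) (V : Site d → Fin d → (Matrix n n ℂ)ˣ)
    (h : Exists8 { torusVP d L N G (k + 1) with OnMinimalOrbit := fun _ V U => IsMinimiser d (sfClass d L N ε₀) L N (k + 1) V U } B₃ ε₁ V) :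
    Exists8 (torusVP d L N G (k + 1)) B₃ ε₁ V := by
  obtain ⟨U₀, hmem, havg, hmin⟩ := h
  exact ⟨U₀, hmem, havg, isMinimiser_of_capture hle hmin hmem⟩

end Faithful

/-! ## §5 A6: (P)-(8) is inhabited at the flat datum, for every pair of radii -/

section Flat

variable {d : ℕ} {n : Type} [Fintype n] [DecidableEq n]

/-- **(P)-(8) ON THE DATA SET `{flatCfg}` FOR ALL RADII `0 ≤ ρ`, `0 ≤ ε⋆` AND EVERY RUN** (`L ≥ 1`): the flat configuration lies in `sfClass d L N ρ (k+1)` and minimises every run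
over `sfClass d L N ε⋆` at the flat datum (`MinimalActionWitness.flatCfg_mem_sfClass`, `isMinimiser_sfClass_flatCfg` BY NAME: zero action, every `U(N)`-valued action is
`≥ 0`).  So the displayed hypothesis `h8P` of §1–§3 is satisfiable (A6 hygiene: said, not hidden; the trivial sector only — nothing about loose non-flat data). [folklore] -/
theorem exists8P_on_flat [Nonempty n] {L : ℕ} (hL : 1 ≤ L) (N : ℕ) {ρ εTop : ℝ} (hρ : 0 ≤ ρ) (hT : 0 ≤ εTop) :
    ∀ V ∈ ({flatCfg} : Set (Site d → Fin d → (Matrix n n ℂ)ˣ)), ∀ k : ℕ, ∃ U₀ : Site d → Fin d → (Matrix n n ℂ)ˣ,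
      U₀ ∈ sfClass d L N ρ (k + 1) ∧ IsMinimiser d (sfClass d L N εTop) L N (k + 1) V U₀ := by
  intro V hV k
  rw [Set.mem_singleton_iff] at hV
  subst hV
  exact ⟨flatCfg, flatCfg_mem_sfClass L N hρ (k + 1), isMinimiser_sfClass_flatCfg hL N hT (k + 1)⟩

end Flat
/-! ## §3b (v1.1) Node N19's `sel` rows at K3⁷ v5's loose pin, uniqueness-free, from (P)-(8) + any per-family loose leaf -/
section AtReadingSel
variable {N : ℕ} [NeZero N]
open Summit.QuantumFields.YangMills.BalabanUVNodes.N16PinnedLayer13CoPH (rateCarriers_ne3_of_pinnedLoose) in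
/-- **★ NODE N19's (v′-16) `sel` ROWS AT EVERY TUPLE AND RUN LENGTH, UNDER THE LOOSE PIN, FROM (P)-(8) + ANY PER-FAMILY LOOSE LEAF — NO UNIQUENESS, NO CAPTURE-∀**
(file 3's `sel_rateCarriers_of_pinnedLoose_of_loose_of_capture` with `hex ∧ hcap` ↦ `h8P` = (P)-(8) at `(ρ F, (ℓ₃ F).ε)` on the pinned loose data `D_F`; other rows as there:
loose leaf at `ρ F ≤ (ℓ₃ F).ε`, match row `ρ F ≤ (ℓ₃ F).b`, `c F ≤ c'`, datum-radius rows at `ε₁ := (ℓ₃ F).ε ∕ B F`).  Proof: module 43's `rateCarriers_ne3_of_pinnedLoose`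
rewrites `R.ne3` to the loose object, then §1's `exists_sel_of_loose_of_exists8P`.  Thm 1 sentence 2 is NOT displayed. [cite: Balaban1985Variational, Thm 1 (8)–(10) p.279] -/
theorem sel_rateCarriers_of_pinnedLoose_of_loose_of_exists8P {𝔯 : RateReading₁₃CoPH N} {ℓ₃ : T4Family → NE3Letters₁₁} {B : T4Family → ℝ}
    (hpin : N16PinnedLoose 𝔯 ℓ₃ B) {ρ c : T4Family → ℝ} (hloose : ∀ F : T4Family, LeafH3sup 4 F.L (ne3NperOfRecord₁₁ F 0 0) (ρ F) (ρ F) (c F)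
      ({V | V ∈ ne3DomOfRecord₁₁ F N 0 0 ∧ V ∈ sfClass 4 F.L (ne3NperOfRecord₁₁ F 0 0) ((ℓ₃ F).ε / B F) 0} : Set (Site 4 → Fin 4 → (MatA N)ˣ)))
    (hρε : ∀ F : T4Family, ρ F ≤ (ℓ₃ F).ε)
    (h8P : ∀ (F : T4Family), ∀ V ∈ ({V | V ∈ ne3DomOfRecord₁₁ F N 0 0 ∧ V ∈ sfClass 4 F.L (ne3NperOfRecord₁₁ F 0 0) ((ℓ₃ F).ε / B F) 0} :
        Set (Site 4 → Fin 4 → (MatA N)ˣ)), ∀ k : ℕ, ∃ U₀ : Site 4 → Fin 4 → (MatA N)ˣ,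
      U₀ ∈ sfClass 4 F.L (ne3NperOfRecord₁₁ F 0 0) (ρ F) (k + 1) ∧ IsMinimiser 4 (sfClass 4 F.L (ne3NperOfRecord₁₁ F 0 0) (ℓ₃ F).ε) F.L (ne3NperOfRecord₁₁ F 0 0) (k + 1) V U₀)
    (hε₁ : ∀ F : T4Family, (ℓ₃ F).ε / B F ≤ (ℓ₃ F).ε ∧ (ℓ₃ F).ε / B F ≤ 1 / 4 ∧ (ℓ₃ F).ε / B F ≤ (ℓ₃ F).b)
    (F : T4Family) (θ : Stage13HParams F N) (hP : θ.Provisos₁₃CoPH F N) (g₀ : ℕ → ℝ) (os : List (ULoop F)) (k : ℕ)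
    {c' : ℝ} (hρb : ρ F ≤ (ℓ₃ F).b) (hc : c F ≤ c') (hε₁c : 4 * ((ℓ₃ F).ε / B F) ≤ c') :
    ∃ sel : ℕ → (Site 4 → Fin 4 → (MatA N)ˣ) → (Site 4 → Fin 4 → (MatA N)ˣ),
      (∀ V ∈ (rateCarriersOfRecord₁₃CoPH 𝔯 F θ hP g₀ os k).ne3.dom, ∀ j : ℕ,
        IsMinimiser 4 (sfClass 4 (rateCarriersOfRecord₁₃CoPH 𝔯 F θ hP g₀ os k).ne3.L (rateCarriersOfRecord₁₃CoPH 𝔯 F θ hP g₀ os k).ne3.Nper (rateCarriersOfRecord₁₃CoPH 𝔯 F θ hP g₀ os k).ne3.ε)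
          (rateCarriersOfRecord₁₃CoPH 𝔯 F θ hP g₀ os k).ne3.L (rateCarriersOfRecord₁₃CoPH 𝔯 F θ hP g₀ os k).ne3.Nper j V (sel j V)) ∧
      (∀ V ∈ (rateCarriersOfRecord₁₃CoPH 𝔯 F θ hP g₀ os k).ne3.dom, ∀ j : ℕ,
        RegularSup 4 (rateCarriersOfRecord₁₃CoPH 𝔯 F θ hP g₀ os k).ne3.L (rateCarriersOfRecord₁₃CoPH 𝔯 F θ hP g₀ os k).ne3.Nper (rateCarriersOfRecord₁₃CoPH 𝔯 F θ hP g₀ os k).ne3.b c' j (sel j V)) := by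
  rw [rateCarriers_ne3_of_pinnedLoose hpin F θ hP g₀ os k]
  exact exists_sel_of_loose_of_exists8P (hloose F) (hρε F) (h8P F) hρb hc (hε₁ F).1 (hε₁ F).2.1 (hε₁ F).2.2 hε₁c (fun V hV => hV.2)

end AtReadingSel

end

end Summit.QuantumFields.YangMills.BalabanUVNodes.N16CaptureOfExists8Problem
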